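import Summits.BirchSwinnertonDyer.BirchSwinnertonDyer.Theses.PrintX10b
import Summits.BirchSwinnertonDyer.BirchSwinnertonDyer.Theorems.PrintX10bHowardContainmentAnyClassNumberX10bThm413Hyp
import Summits.BirchSwinnertonDyer.BirchSwinnertonDyer.Theorems.PrintX10bHowardContainmentLightFrameX10bEnvelope
import Literature.NumberTheory.EllipticCurves.CastellaGrossiSkinner2025.HeegnerKolyvaginBoundAnyClassNumberProofs
import Literature.NumberTheory.EllipticCurves.HeegnerCharIdealEnvelopeProofs
import Literature.NumberTheory.EllipticCurves.HeegnerCharIdealEnvelopePowTransferProofs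
import Literature.NumberTheory.EllipticCurves.IwasawaAlgebraPromotionProofs
import Literature.NumberTheory.EllipticCurves.IwasawaAlgebraMuPromotionProofs
import HarnessLib

/-!
# Line `torsion-depth-x10b-pinned` (rev-35 RESHAPE, x10b-p2 LEAD g3) on the DECIDING crux
# stmt-BirchSwinnertonDyer-27275 `PrintX10b.HowardContainmentLightFrameX10bPinnedOfPrint`
# `:= MastellaZermanHowardDivisibility → CGLSHeegnerClassNonvanishing → CGSHowardDivisibilityPLocalized →
#     AnticyclotomicTowerSharp → HowardContainmentLightFrameX10bPinned` (PrintX10b rev 35, STAMPED REF-124)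

HONEST FRAMING: a SKELETON; `sorry` ONLY in `stub_muInequalityStabilized` (the μ-INEQUALITY in the STABILISED currency,
BEYOND citable PRINT at `3 ∣ h_K` per REF-118); `stub_coprimeTied` and `stub_envelopeSharp0` are PROVED in-file; the
composition `HowardContainmentLightFrameX10bPinnedOfPrint_of_stubs` concludes the crux BY NAME. Nothing closed; no
summit statement proved; BSD is not proved by any of this.

RESHAPE vs the rev-27 skeleton of record (sha 71ca6d74…, g2): the one open stub was `stub_muPartSharp` — the μ-part as an
F-currency PACKAGE (∀ Heegner family `F` on `Dt`, `(p^m)·I(ℋ_F)² ⊆ char ⟹ I(ℋ_F)² ⊆ char`). A port of the μ-argument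
(MZ26 Thm 3.15 (iii) re-based at `p ∣ h_K` per CGLS22 §4.1 / Howard 2004 Thm 2.2.10, specialisation at `q_m = T^m + p`)
delivers the μ-inequality for the Λ-adic CLASS, i.e. in CGLS's STABILISED currency `Λκ_∞(C)`, for every `C`, with no
family `F` and no `Dt`: `μ(𝒳_tors) ≤ 2·μ(𝔖/Λκ_∞(C))`. Bridging `C → F` for an ARBITRARY `F` with `F.Dt = Dt` would need
`ℋ_F ≤ Λκ_∞(C)`, which the tree proves only for the engine's own coherent family (x9-p1-w2 g3 FINDING 10:02:01Z). The
composition never needs an arbitrary `F`: it feeds the engine's coherent pair `(C, F)` (`ℋ_F ≤ Λκ_∞(C)` SHARP, `e = 0`,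
p621830). So the open stub is re-cut to EXACTLY what the port proves (`Stmt.muInequalityStabilized`), the envelope stub
is sharpened to `e = 0` (`Stmt.envelopeSharp0`, PROVED by `X10.envelopeModulesSharp_of_towerSharp`), and the
composition runs in C-currency: thm652 (binder `hCGS`) ⇒ `(p^m)·I(Λκ_C)² ⊆ char(𝒳_tors)`; thm411 (binder `hNV`) ⇒ `𝔖`
torsion-free, `𝔖/Λκ_C` torsion; μ-stub + x10b-p1's promotion (p613811) ⇒ `I(Λκ_C)² ⊆ char(𝒳_tors)`;
`ℋ_F ≤ Λκ_C` ⇒ `I(ℋ_F) ≤ I(Λκ_C)` (`heegnerCharIdeal_le_stabilizedHeegnerCharIdeal_of_le`) ⇒ `I(ℋ_F)² ⊆ char(𝒳_tors)`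
with `F.Dt = Dt` — the LIGHT A₃ containment. `3 ∤ h_K` ↦ `stub_coprimeTied` (MZ26 Cor 4.6 BY NAME, p607508).
-/

set_option linter.dupNamespace false
set_option autoImplicit false

noncomputable section

open scoped Classical Pointwise
open Literature Literature.NumberTheory.EllipticCurves WeierstrassCurve
  Literature.NumberTheory.EllipticCurves.ModularForms
  Literature.NumberTheory.EllipticCurves.CastellaGrossiLeeSkinner2022
open Literature.NumberTheory.EllipticCurves.Rank1Residual (ClassX10 Surj)

namespace Summit.BirchSwinnertonDyer.BirchSwinnertonDyer.Cruxes.HowardContainmentLightFrameX10bPinnedOfPrint.TorsionDepthX10bPinned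

open Summit.BirchSwinnertonDyer.BirchSwinnertonDyer.Theses.PrintX10b
  (MastellaZermanHowardDivisibility CGLSHeegnerClassNonvanishing
    CGSHowardDivisibilityPLocalized AnticyclotomicTowerSharp HowardContainmentLightFrameX10bPinned
    HowardContainmentLightFrameX10bPinnedOfPrint)

/-! ## §1 Stub statements -/

/-- s_cop: the `3 ∤ h_K` regime, tied (MZ26 Cor. 4.6 by name) — UNCHANGED from the rev-27 skeleton. -/
def Stmt.coprimeTied : Prop :=
  MastellaZermanHowardDivisibility →
    ∀ (W : WeierstrassCurve ℚ) [W.IsElliptic] [W.IsGloballyMinimal] (p : ℕ) [Fact p.Prime]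
      [NeZero (W.conductorNorm ℤ)] (K : Type) [Field K] [NumberField K],
      ClassX10 W p → ¬ Surj W 3 → ¬ W.HasCM →
      IsImaginaryQuadratic K → Odd (NumberField.discr K) → NumberField.discr K ≠ -3 →
      SatisfiesHeegnerHypothesis (W.conductorNorm ℤ) K → SatisfiesHeegnerHypothesis p K →
      (W.baseChange K).HasIrreducibleModPGaloisRep p →
      ∀ (κ : ZpExtension K p), κ.IsAnticyclotomic → ∀ (γ : Field.absoluteGaloisGroup K),
      κ.IsTopGenerator γ →
      ∀ (Dt : ModularParametrizationData W (W.conductorNorm ℤ))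
        (H : HeegnerDatum (W.conductorNorm ℤ) (NumberField.discr K)) (ιC : K →+* ℂ)
        (jbar : AlgebraicClosure K →+* ℂ),
      ¬ (p : ℤ) ∣ Dt.c → (W.baseChange K).mordellWeilRank = 1 →
      Finite (AddCommGroup.primaryComponent (W.baseChange K).sha p) →
      ¬ p ∣ NumberField.classNumber K →
      ∃ (D : (W.baseChange K).LambdaAdicSelmerData κ γ)
        (F : HeegnerFamily (W.conductorNorm ℤ) W K κ jbar) (X : (W.baseChange K).SelmerDualData κ γ),
        F.Dt = Dt ∧ heegnerCharIdeal D F ^ 2 ≤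
          Module.charIdeal (IwasawaAlgebra p) (Submodule.torsion (IwasawaAlgebra p) X.X)

/-- s_env0: the PRINT-FREE geometric envelope, SHARP (`e = 0`) — from the sharpened tower, on a light X10b frame, for
the GIVEN `jbar` and EVERY `D`: a COHERENT pair (CGLS datum `C`, Heegner family `F`) on the frame's `Dt` with the two
MODULE inclusions `ℋ_F ≤ Λκ_∞(C)` and `g•Λκ_∞(C) ≤ ℋ_F`, `g ≠ 0`. (rev-27 letter had `(p^e)•ℋ_F ≤ Λκ_∞(C)` with `∃ e`;
the engine gives `e = 0`, which the C-currency composition needs.) -/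
def Stmt.envelopeSharp0 : Prop :=
  AnticyclotomicTowerSharp →
    ∀ (W : WeierstrassCurve ℚ) [W.IsElliptic] [W.IsGloballyMinimal] (p : ℕ) [Fact p.Prime]
      [NeZero (W.conductorNorm ℤ)] (K : Type) [Field K] [NumberField K],
      ClassX10 W p → ¬ Surj W 3 → ¬ W.HasCM →
      IsImaginaryQuadratic K → Odd (NumberField.discr K) → NumberField.discr K ≠ -3 →
      SatisfiesHeegnerHypothesis (W.conductorNorm ℤ) K → SatisfiesHeegnerHypothesis p K →
      (W.baseChange K).HasIrreducibleModPGaloisRep p →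
      ∀ (κ : ZpExtension K p), κ.IsAnticyclotomic → ∀ (γ : Field.absoluteGaloisGroup K),
      κ.IsTopGenerator γ →
      ∀ (Dt : ModularParametrizationData W (W.conductorNorm ℤ))
        (H : HeegnerDatum (W.conductorNorm ℤ) (NumberField.discr K))
        (jbar : AlgebraicClosure K →+* ℂ) (D : (W.baseChange K).LambdaAdicSelmerData κ γ),
      ¬ (p : ℤ) ∣ Dt.c →
      ∃ (C : StabilizedHeegnerData (W.conductorNorm ℤ) W K κ jbar)
        (F : HeegnerFamily (W.conductorNorm ℤ) W K κ jbar) (g : IwasawaAlgebra p),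
        C.Dt = Dt ∧ F.Dt = Dt ∧ g ≠ 0 ∧
        heegnerModule D F ≤ stabilizedHeegnerModule D C ∧
        g • stabilizedHeegnerModule D C ≤ heegnerModule D F

/-- **s_muC: the μ-INEQUALITY in the STABILISED currency** (the ONE open stub; class-number-free SHAPE, no family `F`,
no `Dt`): on every rank-one light X10b Heegner frame with `p ∣ h_K`, for every `jbar`, every Λ-adic Selmer datum `D`,
every CGLS stabilised datum `C` and every dual datum `X` with `𝔖`, `𝒳` finitely generated and `𝔖/Λκ_∞(C)` torsion:
`length_(p)(𝒳_{Λ-tors}) ≤ 2 · length_(p)(𝔖/Λκ_∞(C))`, i.e. `μ(𝒳_tors) ≤ 2 μ(𝔖/Λκ_∞(C))`. The `∀ C` ranges over print's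
coherent datum and its Galois twists / Manin rescalings, at which `μ(𝔖/Λκ_∞(C))` is the same or larger
(`ω_δ·Λκ_∞ ⊆ Λκ_∞(C) ⊆ Λκ_∞`, `p ∤ ω_δ`; `c ↦ m c` multiplies the class by `m`) — so the `∀ C` letter is implied by the
statement at the primitive coherent class and over-CLAIMS nothing. This is what a port of MZ26 Thm 3.15 (iii) / Howard's
`q_m = T^m + p` device proves for the Λ-adic Kolyvagin class at any class number. -/
def Stmt.muInequalityStabilized : Prop :=
    ∀ (W : WeierstrassCurve ℚ) [W.IsElliptic] [W.IsGloballyMinimal] (p : ℕ) [Fact p.Prime]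
      [NeZero (W.conductorNorm ℤ)] (K : Type) [Field K] [NumberField K],
      ClassX10 W p → ¬ Surj W 3 → ¬ W.HasCM →
      IsImaginaryQuadratic K → Odd (NumberField.discr K) → NumberField.discr K ≠ -3 →
      SatisfiesHeegnerHypothesis (W.conductorNorm ℤ) K → SatisfiesHeegnerHypothesis p K →
      (W.baseChange K).HasIrreducibleModPGaloisRep p →
      ∀ (κ : ZpExtension K p), κ.IsAnticyclotomic → ∀ (γ : Field.absoluteGaloisGroup K),
      κ.IsTopGenerator γ →
      (W.baseChange K).mordellWeilRank = 1 →
      Finite (AddCommGroup.primaryComponent (W.baseChange K).sha p) →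
      p ∣ NumberField.classNumber K →
      ∀ (jbar : AlgebraicClosure K →+* ℂ) (D : (W.baseChange K).LambdaAdicSelmerData κ γ)
        (C : StabilizedHeegnerData (W.conductorNorm ℤ) W K κ jbar) (X : (W.baseChange K).SelmerDualData κ γ),
      Module.Finite (IwasawaAlgebra p) D.S → Module.Finite (IwasawaAlgebra p) X.X →
      Module.IsTorsion (IwasawaAlgebra p) (D.S ⧸ stabilizedHeegnerModule D C) →
      ∀ 𝔭 : PrimeSpectrum (IwasawaAlgebra p), 𝔭.asIdeal = Ideal.span {(p : IwasawaAlgebra p)} →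
        Module.lengthAt (IwasawaAlgebra p) (Submodule.torsion (IwasawaAlgebra p) X.X) 𝔭 ≤
          2 * Module.lengthAt (IwasawaAlgebra p) (D.S ⧸ stabilizedHeegnerModule D C) 𝔭

/-- s_muC in the `muInvariant` currency (twin statement, NOT registered; a prover may land either — see the two
compositions below): `μ(𝒳_tors) ≤ 2 μ(𝔖/Λκ_∞(C))` with the tree's `muInvariant`. -/
def Stmt.muInequalityStabilizedInvariant : Prop :=
    ∀ (W : WeierstrassCurve ℚ) [W.IsElliptic] [W.IsGloballyMinimal] (p : ℕ) [Fact p.Prime]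
      [NeZero (W.conductorNorm ℤ)] (K : Type) [Field K] [NumberField K],
      ClassX10 W p → ¬ Surj W 3 → ¬ W.HasCM →
      IsImaginaryQuadratic K → Odd (NumberField.discr K) → NumberField.discr K ≠ -3 →
      SatisfiesHeegnerHypothesis (W.conductorNorm ℤ) K → SatisfiesHeegnerHypothesis p K →
      (W.baseChange K).HasIrreducibleModPGaloisRep p →
      ∀ (κ : ZpExtension K p), κ.IsAnticyclotomic → ∀ (γ : Field.absoluteGaloisGroup K),
      κ.IsTopGenerator γ →
      (W.baseChange K).mordellWeilRank = 1 →
      Finite (AddCommGroup.primaryComponent (W.baseChange K).sha p) →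
      p ∣ NumberField.classNumber K →
      ∀ (jbar : AlgebraicClosure K →+* ℂ) (D : (W.baseChange K).LambdaAdicSelmerData κ γ)
        (C : StabilizedHeegnerData (W.conductorNorm ℤ) W K κ jbar) (X : (W.baseChange K).SelmerDualData κ γ),
      Module.Finite (IwasawaAlgebra p) D.S → Module.Finite (IwasawaAlgebra p) X.X →
      Module.IsTorsion (IwasawaAlgebra p) (D.S ⧸ stabilizedHeegnerModule D C) →
      muInvariant p (Submodule.torsion (IwasawaAlgebra p) X.X) ≤
        2 * muInvariant p (D.S ⧸ stabilizedHeegnerModule D C)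

/-! ## §2 Stubs -/

/-- **stub s_cop (PROVED; MZ26 Cor 4.6 by name at `p = 3`)**, via `X10.heegnerContainmentPinned_of_cor46_of_not_surj`
(p607508). [cite: MastellaZerman2026, Cor. 4.6 (arXiv:2505.08710)] [cite: LombardoTronto2022, Prop. 3.12] -/
theorem stub_coprimeTied : Stmt.coprimeTied := by
  intro hMZ W _ _ p _ _ K _ _ hX hns hcm hK hodd h3 hHN hHp _ κ hκ γ hγ Dt H _ jbar _ _ _ hhK
  have h46 : MastellaZerman2026.cor46_howardDivisibility_of_scalarImage.{0} := hMZ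
  obtain ⟨D, F, X, hFD, -, hle⟩ :=
    Summit.BirchSwinnertonDyer.BirchSwinnertonDyer.Rank1Residual.X10.heegnerContainmentPinned_of_cor46_of_not_surj
      h46 hX hns hcm hK h3 (hK.discr_lt_neg_four_of_odd hodd h3).ne hHN hHp hhK κ hκ γ hγ Dt H jbar
  exact ⟨D, F, X, hFD, hle⟩

/-- **stub s_env0 (PROVED; print-free CM geometry + Kummer theory, `e = 0` by universal norms)**: the frame-generic
coherent-pair engine at `p = 3`, landed as `X10.envelopeModulesSharp_of_towerSharp` (p621830, over x9-p2's
`exists_coherent_pair_envelope` p621134). [cite: Howard2004HeegnerKolyvagin, §3.3, Thm. 3.3.7]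
[cite: PerrinRiou1987BSMF, §3.3–3.4] [cite: CastellaGrossiLeeSkinner2022, §4.1, Rem. 4.1.4] -/
theorem stub_envelopeSharp0 : Stmt.envelopeSharp0 := by
  intro hTw W _ _ p _ _ K _ _ hX hns hcm hK hodd h3 hHN hHp _ κ hκ γ hγ Dt H jbar D _
  have hp : p.Prime := Fact.out
  have hp_odd : Odd p := hp.odd_of_ne_two hX.ne_two
  obtain ⟨C, F, hC, hF, -, -, hfwd, g, hg, hrev⟩ :=
    Summit.BirchSwinnertonDyer.BirchSwinnertonDyer.Rank1Residual.X10.envelopeModulesSharp_of_towerSharp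
      hX hK hodd h3 hHN hHp hκ hγ Dt H jbar (fun k ↦ hTw K p hp_odd hK κ hκ jbar k) D
  exact ⟨C, F, g, hC, hF, hg, hfwd, hrev⟩

/-- **stub s_muC (OPEN; the μ-INEQUALITY `μ(𝒳_tors) ≤ 2·μ(𝔖/Λκ_∞(C))` at `3 ∣ h_K`, BEYOND CITABLE PRINT per
REF-118; portable: MZ26 Thm 3.15 (iii) re-based at K[1] per CGLS22 §4.1 + Howard 2004 Thm 2.2.10 `q_m = T^m + p`).**
[cite: MastellaZerman2026, Thm. 3.15 (iii) (standing Ass. 2.1)] [cite: Howard2004HeegnerKolyvagin, Thm. 2.2.10]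
[cite: CastellaGrossiLeeSkinner2022, §4.1, Thm. 4.1.1] -/
theorem stub_muInequalityStabilized : Stmt.muInequalityStabilized := by
  sorry

/-! ## §3 Composition (sorry-free) -/

/-- Local ALIAS of the crux decl (only `…_of_stubs` concludes the crux by name, for the registry audit). -/
def Goal : Prop := HowardContainmentLightFrameX10bPinnedOfPrint

/-- **Composition (rev-35 shape, C-currency)**: fix the frame, `jbar := IsAlgClosed.lift` along `ιC`; `3 ∤ h_K` ↦
`s_cop hMZ`; `3 ∣ h_K` ↦ `D`, `X` exist; `(C, F, g)` ← `s_env0 hTw♯` with `ℋ_F ≤ Λκ_C`, `g•Λκ_C ≤ ℋ_F`; thm411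
(binder `hNV`) at `(D, C)` ⇒ `𝔖` torsion-free, `𝔖/Λκ_C` torsion ⇒ `𝔖/ℋ_F` torsion; thm652 (binder `hCGS`) at
`(D, C, X)` ⇒ finiteness and `(p^m)·I(Λκ_C)² ⊆ char(𝒳_tors)`; `s_muC` ⇒ `length_(p)(𝒳_tors) ≤ 2·length_(p)(𝔖/Λκ_C)`
⇒ (promotion p613811) `I(Λκ_C)² ⊆ char(𝒳_tors)`; `ℋ_F ≤ Λκ_C` ⇒ `I(ℋ_F) ≤ I(Λκ_C)` ⇒ `I(ℋ_F)² ⊆ char(𝒳_tors)`,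
`F.Dt = Dt`. -/
theorem HowardContainmentLightFrameX10bPinnedOfPrint_of
    (s_cop : Stmt.coprimeTied) (s_env : Stmt.envelopeSharp0) (s_mu : Stmt.muInequalityStabilized) : Goal := by
  unfold Goal HowardContainmentLightFrameX10bPinnedOfPrint
  intro hMZ hNV hCGS hTw W _ _ p _ _ K _ _ hX hns hcm hK hodd h3 hHN hHp hirr κ hκ γ hγ Dt H ιC hc hrk hfin
  letI : Algebra K ℂ := ιC.toAlgebra
  let jbar : AlgebraicClosure K →+* ℂ :=
    (IsAlgClosed.lift (R := K) (M := ℂ) (S := AlgebraicClosure K)).toRingHom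
  by_cases hhK : p ∣ NumberField.classNumber K
  · obtain ⟨D⟩ := LambdaAdicSelmerDataExists.nonempty_lambdaAdicSelmerData (W.baseChange K) p κ hγ
    obtain ⟨X⟩ := (W.baseChange K).nonempty_selmerDualData_holds κ γ hγ
    -- the print-free envelope OUTPUTS the coherent pair `(C, F)` on `Dt` with both module inclusions, SHARP
    obtain ⟨C, F, g, -, hFDt, hg, hle, hrev⟩ :=
      s_env hTw W p K hX hns hcm hK hodd h3 hHN hHp hirr κ hκ γ hγ Dt H jbar D hc
    have hyp := Summit.BirchSwinnertonDyer.BirchSwinnertonDyer.Rank1Residual.X10.thm413Hypotheses_of_classX10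
      hX hK h3 hHN hHp hodd hκ hγ
    -- CGLS Thm. 4.1.1 + Cornut–Vatsal BY NAME at `(D, C)`: torsion-freeness of `𝔖`, torsion of `𝔖/Λκ_C`
    have h411 : CastellaGrossiLeeSkinner2022.thm411_torsionFree_heegnerClass_ne_bot_quotient_isTorsion.{0} := hNV
    obtain ⟨hfree, -, htorC⟩ := h411 (W.conductorNorm ℤ) W K p κ γ jbar hyp D C
    haveI := hfree
    -- CGS Thm. 6.5.2 BY NAME at `(D, C, X)`: finiteness of `𝔖`, `𝒳`, the p-localized bound in C-currency
    have h652 : CastellaGrossiSkinner2025.thm652_stabilized_rankOne_charIdeal_torsion_dvd_pLocalized.{0} := hCGS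
    obtain ⟨⟨hfinS, -⟩, hfinX, -⟩ := h652 (W.conductorNorm ℤ) W K p κ γ jbar hyp D C X
    haveI := hfinS
    haveI := hfinX
    haveI : IsNoetherian (IwasawaAlgebra p) X.X := isNoetherian_of_isNoetherianRing_of_finite _ _
    haveI : Module.Finite (IwasawaAlgebra p) (Submodule.torsion (IwasawaAlgebra p) X.X) := inferInstance
    haveI : Module.Finite (IwasawaAlgebra p) (D.S ⧸ stabilizedHeegnerModule D C) := inferInstance
    obtain ⟨m, hm⟩ := CastellaGrossiSkinner2025.span_pow_mul_sq_le_charIdeal_torsion_of_thm652_stabilized h652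
      hyp D C X
    -- the μ-inequality (open stub) promotes the p-localized C-currency containment to the integral one
    have hμ := s_mu W p K hX hns hcm hK hodd h3 hHN hHp hirr κ hκ γ hγ hrk hfin hhK jbar D C X hfinS hfinX htorC
    have hsqC : stabilizedHeegnerCharIdeal D C ^ 2 ≤
        Module.charIdeal (IwasawaAlgebra p) (Submodule.torsion (IwasawaAlgebra p) X.X) := by
      rw [stabilizedHeegnerCharIdeal_def] at hm ⊢
      exact IwasawaAlgebra.sq_charIdeal_le_charIdeal_of_span_p_pow_mul_le_of_lengthAt_le_two_mul
        (Submodule.torsion_isTorsion (R := IwasawaAlgebra p) (M := X.X)) htorC hμ hm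
    -- torsion of `𝔖/ℋ_F` from the reverse inclusion, then `I(ℋ_F) ≤ I(Λκ_C)` from the sharp forward inclusion
    have htor : Module.IsTorsion (IwasawaAlgebra p) (D.S ⧸ heegnerModule D F) :=
      isTorsion_quotient_heegnerModule_of_smul_stabilizedHeegnerModule_le D F C hg hrev htorC
    have hIF : heegnerCharIdeal D F ≤ stabilizedHeegnerCharIdeal D C :=
      heegnerCharIdeal_le_stabilizedHeegnerCharIdeal_of_le D F C htor hle
    exact ⟨jbar, D, F, X, hFDt, (Ideal.pow_right_mono hIF 2).trans hsqC⟩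
  · obtain ⟨D, F, X, hF, hle⟩ := s_cop hMZ W p K hX hns hcm hK hodd h3 hHN hHp hirr κ hκ γ hγ Dt H ιC jbar hc hrk
      hfin hhK
    exact ⟨jbar, D, F, X, hF, hle⟩

/-- **Composition twin in the `muInvariant` currency** (x10b-p1 / idea-16 promotion
`IwasawaAlgebra.sq_charIdeal_le_charIdeal_of_span_p_pow_mul_le_of_muInvariant_le`, p614273): the same road from
`Stmt.muInequalityStabilizedInvariant`. -/
theorem HowardContainmentLightFrameX10bPinnedOfPrint_of_invariant
    (s_cop : Stmt.coprimeTied) (s_env : Stmt.envelopeSharp0) (s_mu : Stmt.muInequalityStabilizedInvariant) :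
    Goal := by
  unfold Goal HowardContainmentLightFrameX10bPinnedOfPrint
  intro hMZ hNV hCGS hTw W _ _ p _ _ K _ _ hX hns hcm hK hodd h3 hHN hHp hirr κ hκ γ hγ Dt H ιC hc hrk hfin
  letI : Algebra K ℂ := ιC.toAlgebra
  let jbar : AlgebraicClosure K →+* ℂ :=
    (IsAlgClosed.lift (R := K) (M := ℂ) (S := AlgebraicClosure K)).toRingHom
  by_cases hhK : p ∣ NumberField.classNumber K
  · obtain ⟨D⟩ := LambdaAdicSelmerDataExists.nonempty_lambdaAdicSelmerData (W.baseChange K) p κ hγ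
    obtain ⟨X⟩ := (W.baseChange K).nonempty_selmerDualData_holds κ γ hγ
    obtain ⟨C, F, g, -, hFDt, hg, hle, hrev⟩ :=
      s_env hTw W p K hX hns hcm hK hodd h3 hHN hHp hirr κ hκ γ hγ Dt H jbar D hc
    have hyp := Summit.BirchSwinnertonDyer.BirchSwinnertonDyer.Rank1Residual.X10.thm413Hypotheses_of_classX10
      hX hK h3 hHN hHp hodd hκ hγ
    have h411 : CastellaGrossiLeeSkinner2022.thm411_torsionFree_heegnerClass_ne_bot_quotient_isTorsion.{0} := hNV
    obtain ⟨hfree, -, htorC⟩ := h411 (W.conductorNorm ℤ) W K p κ γ jbar hyp D C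
    haveI := hfree
    have h652 : CastellaGrossiSkinner2025.thm652_stabilized_rankOne_charIdeal_torsion_dvd_pLocalized.{0} := hCGS
    obtain ⟨⟨hfinS, -⟩, hfinX, -⟩ := h652 (W.conductorNorm ℤ) W K p κ γ jbar hyp D C X
    haveI := hfinS
    haveI := hfinX
    haveI : IsNoetherian (IwasawaAlgebra p) X.X := isNoetherian_of_isNoetherianRing_of_finite _ _
    haveI : Module.Finite (IwasawaAlgebra p) (Submodule.torsion (IwasawaAlgebra p) X.X) := inferInstance
    haveI : Module.Finite (IwasawaAlgebra p) (D.S ⧸ stabilizedHeegnerModule D C) := inferInstance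
    obtain ⟨m, hm⟩ := CastellaGrossiSkinner2025.span_pow_mul_sq_le_charIdeal_torsion_of_thm652_stabilized h652
      hyp D C X
    have hμ := s_mu W p K hX hns hcm hK hodd h3 hHN hHp hirr κ hκ γ hγ hrk hfin hhK jbar D C X hfinS hfinX htorC
    have hsqC : stabilizedHeegnerCharIdeal D C ^ 2 ≤
        Module.charIdeal (IwasawaAlgebra p) (Submodule.torsion (IwasawaAlgebra p) X.X) := by
      rw [stabilizedHeegnerCharIdeal_def] at hm ⊢
      exact IwasawaAlgebra.sq_charIdeal_le_charIdeal_of_span_p_pow_mul_le_of_muInvariant_le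
        (Submodule.torsion_isTorsion (R := IwasawaAlgebra p) (M := X.X)) htorC hm hμ
    have htor : Module.IsTorsion (IwasawaAlgebra p) (D.S ⧸ heegnerModule D F) :=
      isTorsion_quotient_heegnerModule_of_smul_stabilizedHeegnerModule_le D F C hg hrev htorC
    have hIF : heegnerCharIdeal D F ≤ stabilizedHeegnerCharIdeal D C :=
      heegnerCharIdeal_le_stabilizedHeegnerCharIdeal_of_le D F C htor hle
    exact ⟨jbar, D, F, X, hFDt, (Ideal.pow_right_mono hIF 2).trans hsqC⟩
  · obtain ⟨D, F, X, hF, hle⟩ := s_cop hMZ W p K hX hns hcm hK hodd h3 hHN hHp hirr κ hκ γ hγ Dt H ιC jbar hc hrk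
      hfin hhK
    exact ⟨jbar, D, F, X, hF, hle⟩

/-- the composed line (sorry only through `stub_muInequalityStabilized`). -/
theorem HowardContainmentLightFrameX10bPinnedOfPrint_of_stubs : HowardContainmentLightFrameX10bPinnedOfPrint :=
  (HowardContainmentLightFrameX10bPinnedOfPrint_of stub_coprimeTied stub_envelopeSharp0 stub_muInequalityStabilized :
    Goal)

end Summit.BirchSwinnertonDyer.BirchSwinnertonDyer.Cruxes.HowardContainmentLightFrameX10bPinnedOfPrint.TorsionDepthX10bPinned

end
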